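/-
Copyright (c) 2026 the pub-hodgecm-mathlib formalisation cell (harness21).  Prover seat hodgecm-mathlib-K2E5-p17 (g7), Track B «K2-LIT»,
#184♮ = hLiu418 = `stmt-HodgeConjecture-24832`; #42S payer road, organ S1 (local Siegel–Weil spanning), shared row (R-a) `hcell`
(LEAD F0P6-plan (g14) BATCH #16 (2); K2Liu-p07 (g3) road map 2026-09-04T12:37:33Z; assembler K2Liu-p06 (g4) SPEC-S1 §3∕§4).  File 2 of 2: the group-level decomposition.
-/
import Summits.HodgeConjecture.HodgeConjecture.Theorems.K2LiuLocalSWMiddleCellFrame          -- ★ (R-a) FILE 1: `middleCell_core_zero∕one` (K2E5-p17)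
import Summits.HodgeConjecture.HodgeConjecture.Theorems.K2LiuLocalSWBigCellDecomposition      -- ★ F3c-A: `mem_bigCell_iff_isUnit_det_blkC` (⇒ GR `ofAdapted`, `adapt`, `rel_inv₂₂`, `cstar_matA`)
import Literature.NumberTheory.GelbartRogawski1991.LocalDoubledUnitaryBigCellValue           -- ★ GR: `gramS_map_conj`, `gramS_transpose`, `conjLocal_conjLocal'`
import Mathlib.Tactic.FinCases
import HarnessLib

/-!
# Crux `HLiu418`, organ S1, row (R-a): THE MIDDLE BRUHAT CELL OF `U(2,2)(F_v)`, FILE 2 — off the big cell, `g ∈ P_Δ` or `g = p · w₁ · x` (`p, x ∈ P_Δ`)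

Cell `hodgecm-mathlib`, crux item hLiu418 = `stmt-HodgeConjecture-24832`, route of record `HCCMUnconditional`; squad K2 ∕ K2Liu, prover K2E5-p17 (g7).
THEOREMS ONLY (no `def`, no instance, no notation, no named-fact hypothesis, no `sorry`); lane `--supports stmt-HodgeConjecture-24832 --as helper` (count-neutral).

THE MATHEMATICS ([Kudla1994, §3 Thm. 3.1]; [HarrisKudlaSweet1996, §1 (1.11), (1.15)]; [KudlaSweet1997, §1]): the Bruhat decomposition of the doubled unitary group
`H(F_v) = U(W ⊕ W⁻)(F_v)` with respect to the Siegel parabolic `P_Δ` has the cells `P_Δ w_r P_Δ` indexed by `r = rank C`; for `n = 2`: the closed cell `P_Δ`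
(`C = 0`), the middle cell `P_Δ w₁ P_Δ` (`rank C = 1`, `w₁` the flip of ONE line) and the big cell `P_Δ w_Δ N_Δ` (`C` invertible, ★ F3c-A).  This file proves the
dichotomy OFF the big cell — **`offBigCell_cases`**, literally the hypothesis `hcell` of ★ `K2LiuLocalSWRamifiedMiddleCell.offBigCell_comp_eq_of_cells` (K2Liu-p07, F7r-4)
— at every place `v` where the local algebra `E ⊗ F_v` is a field (`hK`; non-split `v`; at a split place the statement is false), for the flip of either line
`i : Fin 2` given BY VALUE through its adapted matrix (★ F7r `detDelta_localCongr_dA_flipSingle_mul` letters).  The algebra is ★ FILE 1 (`K2LiuLocalSWMiddleCellFrame`);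
here: `flip_mul_self_two` (`w₁² = 1`), `isSiegelDelta_inv_of_blkC` (`P_Δ` is inverse-closed, via the `C`-block), and the assembly through ★ `ofAdapted`,
★ `isSiegelDelta_iff_blkC_eq_zero`, ★ `rel₁₁`∕`rel_inv₂₂`∕`cstar_matA`, ★ `mem_bigCell_iff_isUnit_det_blkC`.
HONEST LABEL: HC_CM is proved only modulo the 7 printed citations (2 remaining named inputs: hLiu418 = stmt-HodgeConjecture-24832, h413 = stmt-HodgeConjecture-24833) until
rung 0 closes; count-neutral helper, closes no item (consumers: the inert∕ramified witness hands' `hf₀off` via K2Liu-p06's assembly).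
Search: tree ★ `K2LiuLocalSWBigCellDecomposition` (pattern `g = p · w_Δ · n(C⁻¹D)`), ★ `K2LiuSiegelLeviWeylAlgebra.matA_inv` (not needed), ★ `K2LiuSiegelBruhatMiddleCellExhaustion`
(global twin); dedup `rg "offBigCell_cases|isSiegelDelta_inv_of_blkC|flip_mul_self_two"` — none.
References: [Kudla1994] S. Kudla, Israel J. Math. 87 (1994), §3; [HarrisKudlaSweet1996] J. AMS 9 (1996), §1; [KudlaSweet1997] S. Kudla, W. Sweet, *Degenerate principal
series representations for `U(n,n)`*, Israel J. Math. 98 (1997), §1.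
-/

set_option autoImplicit false
-- the mandated namespace repeats `HodgeConjecture.HodgeConjecture`
set_option linter.dupNamespace false

noncomputable section

namespace Summit.HodgeConjecture.HodgeConjecture.Cruxes.HLiu418.K2LiuLocalSWMiddleCellBruhat

open NumberField IsDedekindDomain Matrix
open Literature.NumberTheory.Automorphic Literature.NumberTheory.Automorphic.UnitaryGroup
open Literature.NumberTheory.GelbartRogawski1991.AdaptedBlocks
open Literature.NumberTheory.GelbartRogawski1991.UnitaryDualPair.LocalSplitting
open Literature.NumberTheory.K2Lit.LocalSiegelDoubled
open Summit.HodgeConjecture.HodgeConjecture.Cruxes.HLiu418.K2LiuLocalSWBigCellDecomposition (mem_bigCell_iff_isUnit_det_blkC)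
open Summit.HodgeConjecture.HodgeConjecture.Cruxes.HLiu418.K2LiuLocalSWMiddleCellFrame

variable (F : Type) [Field F] [NumberField F] (E : Type) [Field E] [NumberField E] [Algebra F E] [Algebra.IsQuadraticExtension F E]
  (c : E ≃ₐ[F] E)
  {δ : E} (hcδ : c δ = -δ) (hδ : δ ≠ 0) {d : F} (hd : δ * δ = algebraMap F E d)
  (v : HeightOneSpectrum (𝓞 F)) {T₀ : Matrix (Fin 2) (Fin 2) F} (hT₀ : T₀.IsSymm) (hT₀d : IsUnit T₀.det)
  {JD : Matrix (Fin (2 + 2)) (Fin (2 + 2)) E} (hJD : JD = (gramD F 2 T₀).map (algebraMap F E))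

omit [Algebra.IsQuadraticExtension F E] in
/-- **a flip is an involution** (`n = 2` copy of ★ `K2LiuLocalSWRamifiedRankOneSign.flip_mul_self`, restated here to keep this file's imports light): an element with
adapted matrix `[[1 − P, P], [P, 1 − P]]`, `P² = P`, squares to `1`. [cite: Kudla1994, §3] -/
theorem flip_mul_self_two {P : Matrix (Fin 2) (Fin 2) (LocalRing E v)} (hP : P * P = P) {x : UnitaryGroup.localPi E c (2 + 2) JD v}
    (hx : adapt (matA F E c v 2 x) = Matrix.fromBlocks (1 - P) P P (1 - P)) : x * x = 1 := by
  have h1 : (1 - P) * (1 - P) = 1 - P := by rw [sub_mul, one_mul, mul_sub, mul_one, hP, sub_self, sub_zero]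
  have h2 : (1 - P) * P = 0 := by rw [sub_mul, one_mul, hP, sub_self]
  have h3 : P * (1 - P) = 0 := by rw [mul_sub, mul_one, hP, sub_self]
  apply matA_injective F E c v 2
  apply eq_of_adapt_eq
  rw [← matA_mul, adapt_mul, hx, matA_one, adapt_one, Matrix.fromBlocks_multiply]
  simp only [h1, h2, h3, hP, add_zero, sub_add_cancel, add_sub_cancel, Matrix.fromBlocks_one]

include hcδ hδ hd hT₀ hJD in
/-- **`P_Δ(F_v)` is closed under inverses, through the `C`-block**: if `C(y) = 0` and `A(y)` is invertible then `C(y⁻¹) = 0` (`C(y⁻¹) A(y) = C(1) = 0`).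
[cite: Kudla1994, §3] [cite: HarrisKudlaSweet1996, §1 (1.11)] -/
theorem isSiegelDelta_inv_of_blkC {y : UnitaryGroup.localPi E c (2 + 2) JD v} (hy : blkC (matA F E c v 2 y) = 0)
    (hA : IsUnit (blkA (matA F E c v 2 y)).det) : IsSiegelDelta F E c hcδ hδ hd v 2 hT₀ hJD y⁻¹ := by
  rw [isSiegelDelta_iff_blkC_eq_zero F E c hcδ hδ hd v 2 hT₀ hJD]
  have h1 : matA F E c v 2 y⁻¹ * matA F E c v 2 y = 1 := by rw [matA_mul, inv_mul_cancel, matA_one]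
  have h2 := congrArg blkC h1
  rw [blkC_mul, hy, Matrix.mul_zero, add_zero, blkC_one] at h2
  calc blkC (matA F E c v 2 y⁻¹) = blkC (matA F E c v 2 y⁻¹) * blkA (matA F E c v 2 y) * (blkA (matA F E c v 2 y))⁻¹ := by
        rw [Matrix.mul_nonsing_inv_cancel_right _ _ hA]
    _ = 0 := by rw [h2, Matrix.zero_mul]

include hT₀d in
/-- **THE CELL DECOMPOSITION OFF THE BIG CELL FOR `n = 2` — the binder `hcell` of ★ `K2LiuLocalSWRamifiedMiddleCell.offBigCell_comp_eq_of_cells`, BY VALUE.**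
At a place `v` where `E ⊗ F_v` is a field (`hK`: every non-zero element is a unit — the NON-SPLIT case), for the flip `w₁` of the line `i` (adapted matrix
`[[1 − E_{ii}, E_{ii}], [E_{ii}, 1 − E_{ii}]]`) and any `g ∈ H(F_v)` OFF the big cell `P_Δ w_Δ N_Δ`: either `g ∈ P_Δ`, or `g = p · w₁ · x` with `p, x ∈ P_Δ`.
Proof: ★ `mem_bigCell_iff_isUnit_det_blkC` gives `det C(g) = 0`; if `C(g) ≠ 0`, unitarity of `w₁` forces `S₀₁ = 0` (★ `rel₁₁`), the inverse unitarity relation of `g`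
(★ `rel_inv₂₂`) feeds ★ `middleCell_core_zero∕one`, whose output `[[a, b], [0, d]]` is realised as `y ∈ P_Δ` by ★ `ofAdapted`; then `C(g y w₁) = 0`, `p := g y w₁ ∈ P_Δ`,
`x := y⁻¹`, and `g = p w₁ x` by `w₁² = 1`.  (At a SPLIT place the dichotomy is false as stated: `C = (C₁, C₂)` has independent ranks.)
[cite: Kudla1994, §3 Thm. 3.1] [cite: HarrisKudlaSweet1996, §1 (1.11), (1.15)] [cite: KudlaSweet1997, §1] -/
theorem offBigCell_cases (hK : ∀ z : LocalRing E v, z ≠ 0 → IsUnit z) (i : Fin 2) {w₁ : UnitaryGroup.localPi E c (2 + 2) JD v}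
    (hw₁ : adapt (matA F E c v 2 w₁) =
      Matrix.fromBlocks (1 - Matrix.single i i 1) (Matrix.single i i 1) (Matrix.single i i 1) (1 - Matrix.single i i 1))
    (g : UnitaryGroup.localPi E c (2 + 2) JD v)
    (hg : ¬ ∃ p, IsSiegelDelta F E c hcδ hδ hd v 2 hT₀ hJD p ∧ ∃ u ∈ unipDeltaLocal F E c v 2 (JD := JD), g = p * weylDelta F E c v 2 hJD * u) :
    IsSiegelDelta F E c hcδ hδ hd v 2 hT₀ hJD g ∨
      ∃ p x, IsSiegelDelta F E c hcδ hδ hd v 2 hT₀ hJD p ∧ IsSiegelDelta F E c hcδ hδ hd v 2 hT₀ hJD x ∧ g = p * w₁ * x := by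
  classical
  by_cases hC0 : blkC (matA F E c v 2 g) = 0
  · exact Or.inl ((isSiegelDelta_iff_blkC_eq_zero F E c hcδ hδ hd v 2 hT₀ hJD g).2 hC0)
  right
  have hdet : (blkC (matA F E c v 2 g)).det = 0 := by
    by_contra h
    exact hg ((mem_bigCell_iff_isUnit_det_blkC F E c hcδ hδ hd v 2 hT₀ hT₀d hJD g).2 (hK _ h))
  -- letters
  have hSu : IsUnit (gramS F E v 2 T₀).det := isUnit_det_gramS' F E v 2 hT₀d
  have hSt : (gramS F E v 2 T₀)ᵀ = gramS F E v 2 T₀ := gramS_transpose F E v 2 hT₀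
  have hSσ : (gramS F E v 2 T₀).map (conjLocal E c v) = gramS F E v 2 T₀ := gramS_map_conj F E c v 2
  have hσ : ∀ x : LocalRing E v, conjLocal E c v (conjLocal E c v x) = x := conjLocal_conjLocal' F E c hcδ hδ hd v
  -- the inverse unitarity relation `D S⁻¹ Cᴴ + C S⁻¹ Dᴴ = 0` of `g`
  have hrel := rel_inv₂₂ hSu (isUnit_det_matA F E c v 2 g) (cstar_matA F E c v 2 hJD g)
  -- `w₁ ∈ H` forces `S 0 1 = 0`
  have hPP : Matrix.single i i (1 : LocalRing E v) * Matrix.single i i 1 = Matrix.single i i 1 := by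
    rw [Matrix.single_mul_single_same, mul_one]
  have hwA : blkA (matA F E c v 2 w₁) = 1 - Matrix.single i i 1 ∧ blkC (matA F E c v 2 w₁) = Matrix.single i i 1 := by
    have h := hw₁; rw [adapt_eq] at h
    obtain ⟨h1, -, h3, -⟩ := Matrix.fromBlocks_inj.1 h
    exact ⟨h1, h3⟩
  have hS01 : gramS F E v 2 T₀ 0 1 = 0 := by
    have h11 := rel₁₁ (cstar_matA F E c v 2 hJD w₁)
    rw [hwA.1, hwA.2] at h11
    have e := congrFun (congrFun h11 0) 1
    fin_cases i <;>
      simpa [Matrix.mul_apply, Fin.sum_univ_two, Matrix.single, Matrix.one_apply, Matrix.add_apply] using e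
  -- the core
  have hcore : ∃ a b d' : Matrix (Fin 2) (Fin 2) (LocalRing E v), IsUnit a.det ∧ IsUnit d'.det ∧
      (a.map (conjLocal E c v))ᵀ * gramS F E v 2 T₀ * d' = gramS F E v 2 T₀ ∧ (d'.map (conjLocal E c v))ᵀ * gramS F E v 2 T₀ * a = gramS F E v 2 T₀ ∧
      (d'.map (conjLocal E c v))ᵀ * gramS F E v 2 T₀ * b + (b.map (conjLocal E c v))ᵀ * gramS F E v 2 T₀ * d' = 0 ∧
      blkC (matA F E c v 2 g) * a * (1 - Matrix.single i i 1) + (blkC (matA F E c v 2 g) * b + blkD (matA F E c v 2 g) * d') * Matrix.single i i 1 = 0 := by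
    fin_cases i
    · exact middleCell_core_zero hK (conjLocal E c v) hσ _ hSt hSσ hSu hS01 _ _ hrel hC0 hdet
    · exact middleCell_core_one hK (conjLocal E c v) hσ _ hSt hSσ hSu hS01 _ _ hrel hC0 hdet
  obtain ⟨a, b, d', hau, hdu, Y1, Y2, Y5, hblk⟩ := hcore
  -- the element `y ∈ P_Δ` with adapted matrix `[[a, b], [0, d']]`
  have hYu : IsUnit (Matrix.fromBlocks a b 0 d').det := by
    rw [Matrix.det_fromBlocks_zero₂₁]; exact hau.mul hdu
  have hY : ((Matrix.fromBlocks a b 0 d').map (conjLocal E c v))ᵀ * adForm F E v 2 (T₀ := T₀) * Matrix.fromBlocks a b 0 d' =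
      adForm F E v 2 (T₀ := T₀) := by
    rw [adForm, Matrix.fromBlocks_map, Matrix.fromBlocks_transpose, Matrix.fromBlocks_multiply, Matrix.fromBlocks_multiply]
    have h0 : ((0 : Matrix (Fin 2) (Fin 2) (LocalRing E v)).map (conjLocal E c v))ᵀ = 0 := by
      rw [Matrix.map_zero _ (map_zero _), Matrix.transpose_zero]
    simp only [h0, Matrix.mul_zero, Matrix.zero_mul, zero_add, add_zero, Matrix.mul_smul, Matrix.smul_mul, Y1, Y2, ← smul_add, Y5, smul_zero]
  set y := ofAdapted F E c v 2 hJD _ hYu hY with hydef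
  have hyad : adapt (matA F E c v 2 y) = Matrix.fromBlocks a b 0 d' := adapt_matA_ofAdapted F E c v 2 hJD _ hYu hY
  have hyC : blkC (matA F E c v 2 y) = 0 ∧ blkA (matA F E c v 2 y) = a := by
    have h := hyad; rw [adapt_eq] at h
    obtain ⟨h1, -, h3, -⟩ := Matrix.fromBlocks_inj.1 h
    exact ⟨h3, h1⟩
  -- `p := g y w₁ ∈ P_Δ`
  have hp : IsSiegelDelta F E c hcδ hδ hd v 2 hT₀ hJD (g * y * w₁) := by
    rw [isSiegelDelta_iff_blkC_eq_zero F E c hcδ hδ hd v 2 hT₀ hJD, blkC_eq_toBlocks₂₁_adapt, ← matA_mul, ← matA_mul, adapt_mul, adapt_mul, hyad, hw₁,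
      adapt_eq, Matrix.fromBlocks_multiply, Matrix.fromBlocks_multiply, Matrix.toBlocks_fromBlocks₂₁]
    simpa only [Matrix.mul_zero, zero_add, add_zero] using hblk
  refine ⟨g * y * w₁, y⁻¹, hp, isSiegelDelta_inv_of_blkC F E c hcδ hδ hd v hT₀ hJD hyC.1 (hyC.2 ▸ hau), ?_⟩
  show g = g * y * w₁ * w₁ * y⁻¹
  rw [mul_assoc (g * y), flip_mul_self_two F E c v hPP hw₁, mul_one, mul_inv_cancel_right]

end Summit.HodgeConjecture.HodgeConjecture.Cruxes.HLiu418.K2LiuLocalSWMiddleCellBruhat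

end
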